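import Literature.Barriers.Schanuel.EFunctionValuesAtAlgebraicPointsAsymptotics
import Mathlib.Algebra.Order.Floor.Semiring
import HarnessLib

/-!
# Barrier (Schanuel) `EFunctionValuesAtAlgebraicPoints`: growth classes `Bʳ rᶜ` and `Bʳ rᶜ (r!)ᵃ` — proofs only

`Literature/Barriers/Schanuel/EFunctionValuesAtAlgebraicPointsGrowth.lean` — sibling file of
`EFunctionValuesAtAlgebraicPoints.lean` in the programme to discharge `siegelShidlovskii_algIndep`
(Siegel–Shidlovskii; Rivoal Thm. 5.10 = Baker Thm. 11.1). A small calculus to turn the explicit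
bounds of the raw Lemma 4 into Baker's `(r!)^{1+ε}` / `(r!)^{−ν+1+εν}` (Baker, *Transcendental
Number Theory*, Ch. 11, pp. 112–113, where every factor `cʳ`, `rᶜ`, `(r+mj)^{2j}` with
`j ≤ εr + c` is absorbed into `(r!)^{ε}` "if `r` is sufficiently large"):

* `SiegelShidlovskii.IsGP g` — `0 ≤ g r ≤ B^{r+1} (r+1)ᶜ` (geometric × polynomial); closed under
  products, powers, and dominated functions; such `g` are eventually `≤ (r!)^δ` for every
  `δ > 0` (`IsGP.eventually_le`);
* `SiegelShidlovskii.IsGPF a h` — `0 ≤ h r ≤ g r · (r!)ᵃ` with `IsGP g`; products add exponents;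
  the factor `(r+1)^{k⌊εr⌋}` is `IsGPF (2kε)` (`isGPF_succ_pow_mul_floor`, from `rʳ ≤ (r!)²`);
  `IsGPF a h` gives `h r ≤ (r!)^{a+δ}` eventually (`IsGPF.eventually_le`).

All [folklore]; no named facts.

## References

* A. Baker, *Transcendental Number Theory*, CUP 1975, Ch. 11 §3 (pp. 112–113).
-/

noncomputable section

open scoped Nat

namespace Literature.Barriers.Schanuel

namespace SiegelShidlovskii

/-! ### 1. Geometric × polynomial growth -/

/-- `g` grows at most like `B^{r+1} (r+1)ᶜ` and is non-negative. [folklore] -/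
def IsGP (g : ℕ → ℝ) : Prop :=
  ∃ B : ℝ, 1 ≤ B ∧ ∃ c : ℕ, ∀ r : ℕ, 0 ≤ g r ∧ g r ≤ B ^ (r + 1) * ((r : ℝ) + 1) ^ c

namespace IsGP

variable {g g₁ g₂ : ℕ → ℝ}

/-- Non-negativity. [folklore] -/
theorem nonneg (h : IsGP g) (r : ℕ) : 0 ≤ g r := by
  obtain ⟨B, _, c, hB⟩ := h
  exact (hB r).1

/-- Domination. [folklore] -/
theorem mono (h : IsGP g) (h0 : ∀ r, 0 ≤ g₁ r) (hle : ∀ r, g₁ r ≤ g r) : IsGP g₁ := by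
  obtain ⟨B, hB1, c, hB⟩ := h
  exact ⟨B, hB1, c, fun r => ⟨h0 r, (hle r).trans (hB r).2⟩⟩

/-- Products. [folklore] -/
theorem mul (h₁ : IsGP g₁) (h₂ : IsGP g₂) : IsGP fun r => g₁ r * g₂ r := by
  obtain ⟨B₁, hB₁, c₁, h₁⟩ := h₁
  obtain ⟨B₂, hB₂, c₂, h₂⟩ := h₂
  refine ⟨B₁ * B₂, one_le_mul_of_one_le_of_one_le hB₁ hB₂, c₁ + c₂, fun r => ⟨mul_nonneg (h₁ r).1 (h₂ r).1, ?_⟩⟩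
  calc g₁ r * g₂ r ≤ (B₁ ^ (r + 1) * ((r : ℝ) + 1) ^ c₁) * (B₂ ^ (r + 1) * ((r : ℝ) + 1) ^ c₂) :=
        mul_le_mul (h₁ r).2 (h₂ r).2 (h₂ r).1 (by positivity : (0 : ℝ) ≤ B₁ ^ (r + 1) * ((r : ℝ) + 1) ^ c₁)
    _ = (B₁ * B₂) ^ (r + 1) * ((r : ℝ) + 1) ^ (c₁ + c₂) := by rw [mul_pow, pow_add]; ring

/-- Powers. [folklore] -/
theorem pow (h : IsGP g) (k : ℕ) : IsGP fun r => g r ^ k := by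
  obtain ⟨B, hB1, c, hB⟩ := h
  refine ⟨B ^ k, one_le_pow₀ hB1, c * k, fun r => ⟨pow_nonneg (hB r).1 k, ?_⟩⟩
  calc g r ^ k ≤ (B ^ (r + 1) * ((r : ℝ) + 1) ^ c) ^ k := pow_le_pow_left₀ (hB r).1 (hB r).2 k
    _ = (B ^ k) ^ (r + 1) * ((r : ℝ) + 1) ^ (c * k) := by
        rw [mul_pow, ← pow_mul, ← pow_mul, ← pow_mul, mul_comm (r + 1) k]

/-- Sums. [folklore] -/
theorem add (h₁ : IsGP g₁) (h₂ : IsGP g₂) : IsGP fun r => g₁ r + g₂ r := by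
  obtain ⟨B₁, hB₁, c₁, h₁⟩ := h₁
  obtain ⟨B₂, hB₂, c₂, h₂⟩ := h₂
  refine ⟨2 * (B₁ * B₂), by nlinarith, c₁ + c₂, fun r => ⟨add_nonneg (h₁ r).1 (h₂ r).1, ?_⟩⟩
  have hr1 : (1 : ℝ) ≤ (r : ℝ) + 1 := by simp
  have e1 : B₁ ^ (r + 1) * ((r : ℝ) + 1) ^ c₁ ≤ (B₁ * B₂) ^ (r + 1) * ((r : ℝ) + 1) ^ (c₁ + c₂) :=
    mul_le_mul (pow_le_pow_left₀ (by positivity) (le_mul_of_one_le_right (by positivity) hB₂) _)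
      (pow_le_pow_right₀ hr1 (Nat.le_add_right _ _)) (by positivity) (by positivity)
  have e2 : B₂ ^ (r + 1) * ((r : ℝ) + 1) ^ c₂ ≤ (B₁ * B₂) ^ (r + 1) * ((r : ℝ) + 1) ^ (c₁ + c₂) :=
    mul_le_mul (pow_le_pow_left₀ (by positivity) (le_mul_of_one_le_left (by positivity) hB₁) _)
      (pow_le_pow_right₀ hr1 (Nat.le_add_left _ _)) (by positivity) (by positivity)
  calc g₁ r + g₂ r ≤ 2 * ((B₁ * B₂) ^ (r + 1) * ((r : ℝ) + 1) ^ (c₁ + c₂)) := by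
        linarith [(h₁ r).2, (h₂ r).2]
    _ ≤ (2 * (B₁ * B₂)) ^ (r + 1) * ((r : ℝ) + 1) ^ (c₁ + c₂) := by
        have h2 : (2 : ℝ) ≤ 2 ^ (r + 1) :=
          calc (2 : ℝ) = 2 ^ 1 := by norm_num
            _ ≤ 2 ^ (r + 1) := pow_le_pow_right₀ (by norm_num) (by omega)
        have hX : (0 : ℝ) ≤ (B₁ * B₂) ^ (r + 1) * ((r : ℝ) + 1) ^ (c₁ + c₂) := by positivity
        calc 2 * ((B₁ * B₂) ^ (r + 1) * ((r : ℝ) + 1) ^ (c₁ + c₂))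
            ≤ 2 ^ (r + 1) * ((B₁ * B₂) ^ (r + 1) * ((r : ℝ) + 1) ^ (c₁ + c₂)) :=
              mul_le_mul_of_nonneg_right h2 hX
          _ = (2 * (B₁ * B₂)) ^ (r + 1) * ((r : ℝ) + 1) ^ (c₁ + c₂) := by
              rw [mul_pow (2 : ℝ) (B₁ * B₂)]; ring

end IsGP

/-- Constants. [folklore] -/
theorem isGP_const {c : ℝ} (hc : 0 ≤ c) : IsGP fun _ => c := by
  refine ⟨max 1 c, le_max_left _ _, 0, fun r => ⟨hc, ?_⟩⟩
  rw [pow_zero, mul_one]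
  calc c ≤ max 1 c := le_max_right _ _
    _ = max 1 c ^ 1 := (pow_one _).symm
    _ ≤ max 1 c ^ (r + 1) := pow_le_pow_right₀ (le_max_left _ _) (by omega)

/-- `(r+1)ᶜ`. [folklore] -/
theorem isGP_succ_pow (c : ℕ) : IsGP fun r => ((r : ℝ) + 1) ^ c :=
  ⟨1, le_rfl, c, fun r => ⟨by positivity, by rw [one_pow, one_mul]⟩⟩

/-- `B^{a r + b}` for `B ≥ 0`. [folklore] -/
theorem isGP_pow_linear {B : ℝ} (hB : 0 ≤ B) (a b : ℕ) : IsGP fun r => B ^ (a * r + b) := by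
  refine ⟨max 1 B ^ (a + b), one_le_pow₀ (le_max_left _ _), 0, fun r => ⟨pow_nonneg hB _, ?_⟩⟩
  rw [pow_zero, mul_one, ← pow_mul]
  calc B ^ (a * r + b) ≤ max 1 B ^ (a * r + b) := pow_le_pow_left₀ hB (le_max_right _ _) _
    _ ≤ max 1 B ^ ((a + b) * (r + 1)) := pow_le_pow_right₀ (le_max_left _ _) (by nlinarith)

/-- `B^{a ⌊εr⌋ + b}` for `B ≥ 1`, `0 ≤ ε ≤ 1`. [folklore] -/
theorem isGP_pow_floor {B ε : ℝ} (hB : 1 ≤ B) (hε1 : ε ≤ 1) (a b : ℕ) :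
    IsGP fun r => B ^ (a * ⌊ε * r⌋₊ + b) := by
  refine (isGP_pow_linear (le_trans zero_le_one hB) a b).mono (fun r => by positivity) fun r => ?_
  refine pow_le_pow_right₀ hB (Nat.add_le_add_right (Nat.mul_le_mul_left _ ?_) _)
  refine Nat.floor_le_of_le ?_
  calc ε * r ≤ 1 * r := mul_le_mul_of_nonneg_right hε1 (Nat.cast_nonneg _)
    _ = r := one_mul _

/-- Casts of linear functions `a r + b`. [folklore] -/
theorem isGP_natCast_linear (a b : ℕ) : IsGP fun r => ((a * r + b : ℕ) : ℝ) := by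
  refine ⟨max 1 ((a : ℝ) + b), le_max_left _ _, 1, fun r => ⟨Nat.cast_nonneg _, ?_⟩⟩
  rw [pow_one]
  have h1 : ((a * r + b : ℕ) : ℝ) ≤ ((a : ℝ) + b) * ((r : ℝ) + 1) := by push_cast; nlinarith
  refine h1.trans (mul_le_mul_of_nonneg_right ?_ (by positivity))
  calc (a : ℝ) + b ≤ max 1 ((a : ℝ) + b) := le_max_right _ _
    _ = max 1 ((a : ℝ) + b) ^ 1 := (pow_one _).symm
    _ ≤ max 1 ((a : ℝ) + b) ^ (r + 1) := pow_le_pow_right₀ (le_max_left _ _) (by omega)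

/-- `⌊εr⌋` itself (as a real) is `IsGP`. [folklore] -/
theorem isGP_floor {ε : ℝ} (hε1 : ε ≤ 1) : IsGP fun r : ℕ => (⌊ε * r⌋₊ : ℝ) := by
  refine (isGP_natCast_linear 1 0).mono (fun r => Nat.cast_nonneg _) fun r => ?_
  have : ⌊ε * r⌋₊ ≤ r := Nat.floor_le_of_le (by
    calc ε * r ≤ 1 * r := mul_le_mul_of_nonneg_right hε1 (Nat.cast_nonneg _)
      _ = r := one_mul _)
  exact_mod_cast (by omega : ⌊ε * r⌋₊ ≤ 1 * r + 0)

/-- **`IsGP` functions are eventually `≤ (r!)^δ`.** [folklore] -/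
theorem IsGP.eventually_le {g : ℕ → ℝ} (h : IsGP g) {δ : ℝ} (hδ : 0 < δ) :
    ∃ r₀ : ℕ, ∀ r : ℕ, r₀ ≤ r → g r ≤ ((r ! : ℕ) : ℝ) ^ δ := by
  obtain ⟨B, hB1, c, hB⟩ := h
  obtain ⟨r₀, hr₀⟩ := exists_pow_mul_pow_le_factorial_rpow (B := B * B)
    (one_le_mul_of_one_le_of_one_le hB1 hB1) c hδ
  refine ⟨max r₀ 1, fun r hr => ((hB r).2.trans ?_).trans (hr₀ r (le_of_max_le_left hr))⟩
  have hr1 : 1 ≤ r := le_of_max_le_right hr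
  refine mul_le_mul_of_nonneg_right ?_ (by positivity)
  rw [mul_pow, pow_succ]
  refine mul_le_mul_of_nonneg_left ?_ (by positivity)
  calc B = B ^ 1 := (pow_one B).symm
    _ ≤ B ^ r := pow_le_pow_right₀ hB1 hr1

/-! ### 2. Growth with a factorial power -/

/-- `h` is non-negative and bounded by an `IsGP` function times `(r!)ᵃ`. [folklore] -/
def IsGPF (a : ℝ) (h : ℕ → ℝ) : Prop :=
  ∃ g : ℕ → ℝ, IsGP g ∧ ∀ r : ℕ, 0 ≤ h r ∧ h r ≤ g r * ((r ! : ℕ) : ℝ) ^ a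

/-- `1 ≤ r!` as a real. [folklore] -/
theorem one_le_factorial_cast (r : ℕ) : (1 : ℝ) ≤ ((r ! : ℕ) : ℝ) := by
  exact_mod_cast Nat.one_le_iff_ne_zero.mpr r.factorial_ne_zero

namespace IsGPF

variable {a b : ℝ} {f f₁ f₂ : ℕ → ℝ}

/-- Non-negativity. [folklore] -/
theorem nonneg (h : IsGPF a f) (r : ℕ) : 0 ≤ f r := by
  obtain ⟨g, _, hg⟩ := h; exact (hg r).1

/-- Domination. [folklore] -/
theorem mono (h : IsGPF a f) (h0 : ∀ r, 0 ≤ f₁ r) (hle : ∀ r, f₁ r ≤ f r) : IsGPF a f₁ := by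
  obtain ⟨g, hg, hb⟩ := h
  exact ⟨g, hg, fun r => ⟨h0 r, (hle r).trans (hb r).2⟩⟩

/-- Increasing the exponent. [folklore] -/
theorem of_exponent_le (h : IsGPF a f) (hab : a ≤ b) : IsGPF b f := by
  obtain ⟨g, hg, hb⟩ := h
  refine ⟨g, hg, fun r => ⟨(hb r).1, (hb r).2.trans ?_⟩⟩
  exact mul_le_mul_of_nonneg_left
    (Real.rpow_le_rpow_of_exponent_le (one_le_factorial_cast r) hab) (hg.nonneg r)

/-- Products add exponents. [folklore] -/
theorem mul (h₁ : IsGPF a f₁) (h₂ : IsGPF b f₂) : IsGPF (a + b) fun r => f₁ r * f₂ r := by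
  obtain ⟨g₁, hg₁, hb₁⟩ := h₁
  obtain ⟨g₂, hg₂, hb₂⟩ := h₂
  refine ⟨_, hg₁.mul hg₂, fun r => ⟨mul_nonneg (hb₁ r).1 (hb₂ r).1, ?_⟩⟩
  have hF : (0 : ℝ) < ((r ! : ℕ) : ℝ) := by exact_mod_cast Nat.factorial_pos r
  calc f₁ r * f₂ r ≤ (g₁ r * ((r ! : ℕ) : ℝ) ^ a) * (g₂ r * ((r ! : ℕ) : ℝ) ^ b) :=
        mul_le_mul (hb₁ r).2 (hb₂ r).2 (hb₂ r).1 (mul_nonneg (hg₁.nonneg r) (by positivity))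
    _ = g₁ r * g₂ r * ((r ! : ℕ) : ℝ) ^ (a + b) := by rw [Real.rpow_add hF]; ring

/-- Powers multiply the exponent. [folklore] -/
theorem pow (h : IsGPF a f) (k : ℕ) : IsGPF (k * a) fun r => f r ^ k := by
  obtain ⟨g, hg, hb⟩ := h
  refine ⟨_, hg.pow k, fun r => ⟨pow_nonneg (hb r).1 k, ?_⟩⟩
  calc f r ^ k ≤ (g r * ((r ! : ℕ) : ℝ) ^ a) ^ k := pow_le_pow_left₀ (hb r).1 (hb r).2 k
    _ = g r ^ k * ((r ! : ℕ) : ℝ) ^ (k * a) := by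
        rw [mul_pow, ← Real.rpow_natCast (((r ! : ℕ) : ℝ) ^ a), ← Real.rpow_mul (Nat.cast_nonneg _),
          mul_comm a]

/-- **`IsGPF a` functions are eventually `≤ (r!)^{a+δ}`.** [folklore] -/
theorem eventually_le (h : IsGPF a f) {δ : ℝ} (hδ : 0 < δ) :
    ∃ r₀ : ℕ, ∀ r : ℕ, r₀ ≤ r → f r ≤ ((r ! : ℕ) : ℝ) ^ (a + δ) := by
  obtain ⟨g, hg, hb⟩ := h
  obtain ⟨r₀, hr₀⟩ := hg.eventually_le hδ
  refine ⟨r₀, fun r hr => (hb r).2.trans ?_⟩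
  have hF : (0 : ℝ) < ((r ! : ℕ) : ℝ) := by exact_mod_cast Nat.factorial_pos r
  rw [add_comm, Real.rpow_add hF]
  exact mul_le_mul_of_nonneg_right (hr₀ r hr) (by positivity)

end IsGPF

/-- `IsGP` functions are `IsGPF 0`. [folklore] -/
theorem IsGP.isGPF {g : ℕ → ℝ} (h : IsGP g) : IsGPF 0 g :=
  ⟨g, h, fun r => ⟨h.nonneg r, by rw [Real.rpow_zero, mul_one]⟩⟩

/-- `(r!)ᵏ` is `IsGPF k`. [folklore] -/
theorem isGPF_factorial_pow (k : ℕ) : IsGPF k fun r => ((r ! : ℕ) : ℝ) ^ k :=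
  ⟨fun _ => 1, isGP_const zero_le_one, fun r => ⟨by positivity, by rw [one_mul, Real.rpow_natCast]⟩⟩

/-- `r!` is `IsGPF 1`. [folklore] -/
theorem isGPF_factorial : IsGPF 1 fun r => ((r ! : ℕ) : ℝ) := by
  simpa using isGPF_factorial_pow 1

/-- **The factor `(r+1)^{k ⌊εr⌋}` is `IsGPF (2kε)`** (via `(r+1)^{εr} ≤ ((r+1)!)^{2ε}`). [folklore] -/
theorem isGPF_succ_pow_mul_floor (k : ℕ) {ε : ℝ} (hε0 : 0 ≤ ε) (hε1 : ε ≤ 1) :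
    IsGPF (2 * k * ε) fun r => ((r : ℝ) + 1) ^ (k * ⌊ε * r⌋₊) := by
  refine ⟨fun r => (((r : ℝ) + 1) ^ 2) ^ k, (isGP_succ_pow 2).pow k, fun r => ⟨by positivity, ?_⟩⟩
  have hr1 : (1 : ℝ) ≤ (r : ℝ) + 1 := by simp
  have hr0 : (0 : ℝ) ≤ (r : ℝ) + 1 := by positivity
  have hF1 := one_le_factorial_cast r
  -- Step 1: `(r+1)^{εr} ≤ (r+1)^2 (r!)^{2ε}`
  have key : ((r : ℝ) + 1) ^ (ε * r) ≤ ((r : ℝ) + 1) ^ 2 * ((r ! : ℕ) : ℝ) ^ (2 * ε) := by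
    have h1 : ((r : ℝ) + 1) ^ (ε * r) ≤ ((r : ℝ) + 1) ^ (ε * ((r : ℝ) + 1)) :=
      Real.rpow_le_rpow_of_exponent_le hr1 (by nlinarith)
    have h2 : ((r : ℝ) + 1) ^ (ε * ((r : ℝ) + 1)) = ((((r + 1 : ℕ) : ℝ)) ^ (r + 1)) ^ ε := by
      rw [mul_comm, Real.rpow_mul hr0, ← Real.rpow_natCast]
      push_cast
      ring_nf
    have h3 : ((((r + 1 : ℕ) : ℝ)) ^ (r + 1)) ≤ (((r + 1)! : ℕ) : ℝ) ^ 2 := by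
      exact_mod_cast pow_self_le_factorial_sq (r + 1)
    have h4 : ((((r + 1 : ℕ) : ℝ)) ^ (r + 1)) ^ ε ≤ ((((r + 1)! : ℕ) : ℝ) ^ 2) ^ ε :=
      Real.rpow_le_rpow (by positivity) h3 hε0
    have h5 : ((((r + 1)! : ℕ) : ℝ) ^ 2) ^ ε = ((r : ℝ) + 1) ^ (2 * ε) * ((r ! : ℕ) : ℝ) ^ (2 * ε) := by
      rw [← Real.rpow_natCast, ← Real.rpow_mul (Nat.cast_nonneg _), Nat.factorial_succ, Nat.cast_mul,
        Real.mul_rpow (Nat.cast_nonneg _) (Nat.cast_nonneg _)]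
      push_cast
      ring_nf
    have h6 : ((r : ℝ) + 1) ^ (2 * ε) ≤ ((r : ℝ) + 1) ^ 2 := by
      rw [← Real.rpow_natCast _ 2]
      exact Real.rpow_le_rpow_of_exponent_le hr1 (by push_cast; nlinarith)
    calc ((r : ℝ) + 1) ^ (ε * r) ≤ ((((r + 1 : ℕ) : ℝ)) ^ (r + 1)) ^ ε := by rw [← h2]; exact h1
      _ ≤ ((r : ℝ) + 1) ^ (2 * ε) * ((r ! : ℕ) : ℝ) ^ (2 * ε) := by rw [← h5]; exact h4
      _ ≤ ((r : ℝ) + 1) ^ 2 * ((r ! : ℕ) : ℝ) ^ (2 * ε) :=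
          mul_le_mul_of_nonneg_right h6 (by positivity)
  -- Step 2: `(r+1)^{k⌊εr⌋} ≤ ((r+1)^{εr})^k`
  have hfl : ((k * ⌊ε * r⌋₊ : ℕ) : ℝ) ≤ k * (ε * r) := by
    push_cast
    exact mul_le_mul_of_nonneg_left (Nat.floor_le (by positivity)) (Nat.cast_nonneg _)
  calc ((r : ℝ) + 1) ^ (k * ⌊ε * r⌋₊) = ((r : ℝ) + 1) ^ (((k * ⌊ε * r⌋₊ : ℕ) : ℝ)) :=
        (Real.rpow_natCast _ _).symm
    _ ≤ ((r : ℝ) + 1) ^ ((k : ℝ) * (ε * r)) := Real.rpow_le_rpow_of_exponent_le hr1 hfl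
    _ = (((r : ℝ) + 1) ^ (ε * r)) ^ k := by
        rw [mul_comm (k : ℝ), Real.rpow_mul hr0, Real.rpow_natCast]
    _ ≤ (((r : ℝ) + 1) ^ 2 * ((r ! : ℕ) : ℝ) ^ (2 * ε)) ^ k := pow_le_pow_left₀ (by positivity) key k
    _ = (((r : ℝ) + 1) ^ 2) ^ k * ((r ! : ℕ) : ℝ) ^ (2 * k * ε) := by
        rw [mul_pow, ← Real.rpow_natCast (((r ! : ℕ) : ℝ) ^ (2 * ε)), ← Real.rpow_mul (Nat.cast_nonneg _)]
        ring_nf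

end SiegelShidlovskii

end Literature.Barriers.Schanuel

end
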